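import Summits.CriticalPhenomena.SAWScalingLimit.Theorems.SAWRenewalTightnessRoomPassageEvents
import HarnessLib

/-!
# Proper pasts and early approach of the target — events of the r9 passage of the line `room-entropy-wright-fisher`
(crux `SubseqIdentification`, stmt-CriticalPhenomena-0783; lead prover, crux protocol; skeleton
`Summits/CriticalPhenomena/SAWScalingLimit/Cruxes/SubseqIdentification/Lines/room_entropy_wright_fisher.lean`)

Third events file (after `Theorems/SAWRenewalTightnessRoomPassageEvents.lean`, p117606, and the guarded event
`roomDataEventPos` of `Theorems/SAWRenewalTightnessSubseqIdentificationLatticeRoomDataNRReduction.lean`, p120877).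
Reshape r9 follows two worker findings: (i) a past whose polyline passes THROUGH the target `b = D.pt 1 = φ(∞)`
(possible when `b` is interior to a lattice edge) has a pulled-back trace through `∞` and a junk hull functional,
so the room-data approximation must not be claimed there ((H2) worker, `stub-misstated`); (ii) positivity of the
capacity does NOT certify that the polyline avoids `b` (degeneracy worker, `stub-false` for pathological Jordan
domains with summable fingers: `HasHydroMap` can hold for an unbounded pulled-back hull), so PROPERNESS
`D.pt 1 ∉ range (polyline of the past)` is put into the scope of the event itself, and the assembly discharges it
at its first-passage pasts by a separate input: along describable mesh sequences the walk does not come `r`-close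
to `b` while its past still has capacity `≤ T` (`NoEarlyApproachAlong`; limit classes reach `b` only at the end
and the capacity at the first entrance into `B(b, r)` diverges as `r → 0`). Definitions only:

* `roomDataEventProper D φ δ a b z w R r ε` — as `roomDataEventPos` with the extra scope condition that the
  polyline of the witnessing past avoids `D.pt 1`;
* `earlyApproachEvent D φ δ a b T r` — some past of capacity `≤ T` ends within distance `r` of `D.pt 1`;
* `NoEarlyApproachAlong D φ a b s` — along the meshes `s n`, for every `T` and `ε > 0` some `r > 0` makes the
  early-approach event `ε`-unlikely for all large `n`.
-/

noncomputable section

open MeasureTheory Filter Topology Set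
open scoped NNReal ENNReal Classical BigOperators
open Literature.Probability.LatticeModels
open Literature.Probability.RandomPlanarGeometry
open UpperHalfPlane (upperHalfPlaneSet)

namespace Summit.CriticalPhenomena.SAWScalingLimit.Theorems.SubseqIdentification.RoomEntropy

/-- **The proper room-data bad event** at the lattice point `z` (near `φ w`), scales `R > r > 0` and tolerance
`ε`: at some past `γ[0,n]` of positive capacity `≤ (Im w)²/16` WHOSE POLYLINE AVOIDS THE TARGET `D.pt 1`, along a
walk that never comes back within `r` of `a = D.pt 0` after having been at distance `≥ R`, the exact Doob
martingale `roomDoob` misses the hull functional `hullRoomObs K_n ξ_n w` by more than `ε`. [folklore] -/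
def roomDataEventProper (D : DobrushinDomain) (φ : ConformalEquiv upperHalfPlaneSet D.carrier) (δ : ℝ)
    (a b z : Site 2) (w : ℂ) (R r ε : ℝ) : Set (SAW.DomainSAW D.carrier δ a b) :=
  {γ | ∃ n : ℕ, D.pt 1 ∉ Set.range ((prefixAt γ n).toCurve (meshPoint δ)) ∧
    0 < LatticeSlit.capTime φ (prefixAt γ n) ∧
    LatticeSlit.capTime φ (prefixAt γ n) ≤ w.im ^ 2 / 16 ∧
    (∀ i k : ℕ, i < k → R ≤ dist (meshPoint δ (γ.walk.getVert i)) (D.pt 0) →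
      r < dist (meshPoint δ (γ.walk.getVert k)) (D.pt 0)) ∧
    ε < |roomDoob D δ a b z γ n -
      hullRoomObs (LatticeSlit.pastHull φ (prefixAt γ n)) (LatticeSlit.drivingValue φ (prefixAt γ n)) w|}

/-- **The early-approach event** at horizon `T` and radius `r`: some past of capacity `≤ T` has its tip within
distance `r` of the target `D.pt 1`. [folklore] -/
def earlyApproachEvent (D : DobrushinDomain) (φ : ConformalEquiv upperHalfPlaneSet D.carrier) (δ : ℝ)
    (a b : Site 2) (T r : ℝ) : Set (SAW.DomainSAW D.carrier δ a b) :=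
  {γ | ∃ k : ℕ, LatticeSlit.capTime φ (prefixAt γ k) ≤ T ∧
    dist (meshPoint δ (γ.walk.getVert k)) (D.pt 1) ≤ r}

/-- **No early approach of the target along the meshes `s n`**: for every horizon `T` and `ε > 0` some `r > 0`
makes the early-approach event `earlyApproachEvent D φ (s n) (a (s n)) (b (s n)) T r` `ε`-unlikely for all large
`n`. (For describable subsequential limits: a described class reaches `b = φ(∞)` only at the final time and the
capacity of its pull-back at the first entrance into `B(b, r)` diverges as `r → 0`; capacities of lattice pasts
converge by Hausdorff convergence of their generators.) [folklore] -/
def NoEarlyApproachAlong (D : DobrushinDomain) (φ : ConformalEquiv upperHalfPlaneSet D.carrier)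
    (a b : ℝ → Site 2) (s : ℕ → ℝ) : Prop :=
  ∀ T ε : ℝ, 0 < ε → ∃ r : ℝ, 0 < r ∧ ∀ᶠ n in atTop,
    SAW.law D.carrier (s n) (a (s n)) (b (s n)) (earlyApproachEvent D φ (s n) (a (s n)) (b (s n)) T r)
      ≤ ENNReal.ofReal ε

/-! ## Trivial API -/

/-- The early-approach event only shrinks when the radius shrinks. [folklore] -/
theorem earlyApproachEvent_mono (D : DobrushinDomain) (φ : ConformalEquiv upperHalfPlaneSet D.carrier) (δ : ℝ)
    (a b : Site 2) (T : ℝ) {r r' : ℝ} (h : r ≤ r') :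
    earlyApproachEvent D φ δ a b T r ⊆ earlyApproachEvent D φ δ a b T r' := by
  rintro γ ⟨k, hk, hr⟩
  exact ⟨k, hk, hr.trans h⟩

/-- A walk in the proper room-data event witnesses it at a past avoiding the target. [folklore] -/
theorem exists_notMem_of_mem_roomDataEventProper {D : DobrushinDomain}
    {φ : ConformalEquiv upperHalfPlaneSet D.carrier} {δ : ℝ} {a b z : Site 2} {w : ℂ} {R r ε : ℝ}
    {γ : SAW.DomainSAW D.carrier δ a b} (h : γ ∈ roomDataEventProper D φ δ a b z w R r ε) :
    ∃ n : ℕ, D.pt 1 ∉ Set.range ((prefixAt γ n).toCurve (meshPoint δ)) := by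
  obtain ⟨n, hn, -⟩ := h
  exact ⟨n, hn⟩

end Summit.CriticalPhenomena.SAWScalingLimit.Theorems.SubseqIdentification.RoomEntropy

end
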